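import Summits.BirchSwinnertonDyer.BirchSwinnertonDyer.Theorems.GoldfeldAllTwistsTwoConverseTwinNonSharpRankThreeC1C2
import Summits.BirchSwinnertonDyer.BirchSwinnertonDyer.Theorems.GoldfeldAllTwistsTwoConverseTwinNonSharpRankThreeB31B71
import Summits.BirchSwinnertonDyer.BirchSwinnertonDyer.Theorems.GoldfeldAllTwistsTwoConverseTwinAdditiveTamagawaOdd
import HarnessLib

set_option linter.dupNamespace false -- namespace `…BirchSwinnertonDyer.BirchSwinnertonDyer…` is the cell's (D-0017 nested layout)
set_option autoImplicit false

/-!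
# The four NON-SHARP `(4,8)` cells C1, C2, b31+, b71+ of `W ≅ 49a1^{(−2qp)}` each carry a member of Mordell–Weil rank `≥ 3` (kernel,
# files `…TwinNonSharpRankThreeC1C2` / `…B31B71`), so the cell hypothesis `hcell` of the rank-axis capstone
# `analyticRank_eq_one_twoPrimesTwist_sharpLocus_of_print` CANNOT BE DROPPED — cell by cell, for the non-sharp locus, and for the capstone's
# binders as a whole: THEOREM A⁗ is best possible at the level of the sixteen cells

Cell `bsd-goldfeld`, seat `bsd-goldfeld-s1p-c3x` (gen 21); planner RULING (cdxxxiii), OBJECT 9 «NON-SHARP RANK-THREE KERNEL CERTIFICATES».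
`--supports stmt-BirchSwinnertonDyer-20044` as a HELPER (rank axis): a TIGHTNESS / OBSTRUCTION certificate, not a closer. Theses-free; theorems only;
no definition, no named-fact binder (`variable`/`include` = 0), no `sorry`; every numerical claim is re-verified by the kernel.

THE FAMILY AND ITS SIXTEEN CELLS (capstone `…TwinQuarterTraceSharpLocusUnion` (R p725669), §0 `twoPrimes_sharpLocus_or_nonSharp`): primes `q > 3`,
`q ≡ 3 (mod 4)`, `(q/7) = −1`, and `p ≡ 1 (mod 4)`, `(−7/p) = +1`; type β ⟺ `−7` is a fourth power mod `p` (else type α). On TWELVE cells the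
capstone proves `r_an(W) = rank W(ℚ) = 1 ∧ Ш(W)` finite for EVERY `W ≅ 49a1^{(−2qp)}` (modulo SEVENTEEN named prints); its hypothesis `hcell`
excludes exactly C1 (`(p/q) = −1`, `q ≡ 3 (8)`, α, `p ≡ 1 (8)`), C2 (same with `p ≡ 5 (8)`), b31+ (`(p/q) = +1`, β, `p ≡ 1 (8)`, `q ≡ 3 (8)`),
b71+ (same with `q ≡ 7 (8)`) — the cells where the `2`-isogeny Selmer pair of `W` is `(4, 8)` — and its docstrings record rank-`3` members there
as PARI NUMERICS («not kernel»). OBJECT 9 makes them THEOREMS, one witness per cell — `(q,p) = (19,337)` [C1] and `(19,37)` [C2] (file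
`…TwinNonSharpRankThreeC1C2`), `(139,193)` [b31+] and `(311,193)` [b71+] (file `…TwinNonSharpRankThreeB31B71`), and the NEGATIONS «the capstone's
`hcell` cannot be dropped, cell by cell and as a whole» (file `…TwinNonSharpRankThree`). The gate's 400-line lint splits the object into three files.

METHOD (fact-free; the tree's explicit descent via `2`-isogeny — the planted-rank kernel `Summits/BirchSwinnertonDyer/Rank2/TwoIsogenyPlantedRankKernel.lean`
(`add_le_mordellWeilRank_add_two_of_card_le`: `2^i` classes in `α(E(ℚ))` and `2^j` in `ᾱ(E′(ℚ))` ⇒ `i + j ≤ rank + 2`, from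
`WeierstrassCurve.natCard_range_xSqClass_mul` = Silverman–Tate §3.6 with the tree's Mordell–Weil theorem) and the helpers of the accepted rank-`3`
certificate `…Theorems/EisensteinDepletionAtTwoFamily81517Rank3Cert.lean`): on the two-torsion model `E = E_{a,b} = [0, −42qp, 0, 448q²p², 0]`
(`= (⟨(mk0 2)⁻¹, 2d, 0, 0⟩ * C) • W` for `C • W = cm7^{(d)}`, `d = −2qp`, `smul_eq_twoTorsionModel_of_smul_eq_quadraticTwist`) and its `2`-isogenous
curve `E′ = [0, 84qp, 0, −28q²p², 0]`, explicit rational points give FOUR square classes in `α(E(ℚ))` and EIGHT in `ᾱ(E′(ℚ))` (`α = xSqClass`,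
Silverman–Tate §3.5), so `3 ≤ rank E(ℚ)`, transported to every model `W` by `mordellWeilRank_variableChange_holds`. The upper bound `rank ≤ 3`
(`#S = 4`, `#S′ = 8`; PARI `ellrank = [3, 3, 0]`) is NOT re-proved; only the lower bound is used. Points: PARI/GP 2.17 `ellrank` + `ellsaturation`,
kit j333313 (`rank3.gp`); every claim below is re-verified by the kernel (`norm_num`).

THIS FILE: §1 the cell-membership arithmetic of the four pairs (`norm_num` for primality / residues / Jacobi symbols; «`−7` is (not) a fourth
power mod `p`» by `decide` for `p = 37, 193` and by Fermat + `decide +kernel` for `p = 337`); §2 the NEGATIONS — per cell (binders = the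
capstone's LETTER FOR LETTER minus `hcell`, plus that cell's clause in the vocabulary of the capstone's §0 `twoPrimes_sharpLocus_or_nonSharp`),
for the capstone's non-sharp complement clause (`not_forall_mordellWeilRank_eq_one_nonSharpLocus`), and for the capstone's binders with `hcell`
simply deleted (`not_forall_mordellWeilRank_eq_one_twoPrimesTwist`); each is refuted by instantiating a kernel witness `3 ≤ rank W(ℚ)`
(`three_le_mordellWeilRank_twoPrimesTwist_{19_337, 19_37, 139_193, 311_193}`) at `W = cm7^{(−2qp)}` itself (`C = 1`); `(−7/p) = (p/7)` is the lane's
`legendreSym_neg_seven_eq_jacobiSym` (`…TwinAdditiveTamagawaOdd`).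

HONEST FRAMING: a tightness / obstruction certificate on explicit twists inside twist-density-ZERO cells; it certifies that NO cell-uniform
rank-one statement extends the capstone to C1 / C2 / b31+ / b71+ and changes NO width (C1/C2, b31+/b71+ remain director width — this certifies why);
it says nothing about the cells' rank-one members (where the quarter-point device is silent, memo `HOME/NONSHARP-CHIZ-VANISHING.md`), nothing about
`r_an` (PARI's `r_an = 3` stays numerics) and nothing about density; not a closer of any item; items 19350 / 20044 / 19140 SUPPORT only and unchanged;
BSD is not proved by any of this.

References: [SilvermanTate2015] §3.5 (the map `α`), §3.6 (`2^r = #α(Γ)·#ᾱ(Γ̄)/4`); [SilvermanAEC2009] III.3.1(b), VIII.6, Prop. X.4.9, Example X.4.10.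
-/

noncomputable section

open scoped Classical

open WeierstrassCurve Literature.NumberTheory.EllipticCurves

namespace Summit.BirchSwinnertonDyer.BirchSwinnertonDyer.Theorems.GoldfeldGoodTwists

/-! ## §1 Cell membership of the four witnesses (pure arithmetic) -/
section Cells

/-- `(q,p) = (19,337)` lies on cell C1: `q ≡ 3 (8)`, `(q/7) = −1`, `p ≡ 1 (8)`, `(p/7) = (−7/p) = +1`, `(p/q) = −1`, and `−7` is NOT a fourth power
mod `337` (type α) — by Fermat: `x⁴ = −7` would give `(−7)^84 = x^336 = 1` in `ZMod 337`, but `(−7)^84 ≠ 1` there (`decide +kernel`). [folklore] -/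
theorem cellC1_19_337 : Nat.Prime 19 ∧ Nat.Prime 337 ∧ 19 % 8 = 3 ∧ jacobiSym 19 7 = -1 ∧ 337 % 8 = 1 ∧ jacobiSym 337 7 = 1 ∧
    jacobiSym 337 19 = -1 ∧ ¬ ∃ x : ZMod 337, x ^ 4 = -7 := by
  refine ⟨by norm_num, by norm_num, by norm_num, by norm_num, by norm_num, by norm_num, by norm_num, ?_⟩
  rintro ⟨x, hx⟩
  have hx0 : x ≠ 0 := by
    rintro rfl
    revert hx
    decide
  have key : (-7 : ZMod 337) ^ 84 ≠ 1 := by decide +kernel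
  haveI : Fact (Nat.Prime 337) := ⟨by norm_num⟩
  have h1 := ZMod.pow_card_sub_one_eq_one hx0
  rw [show 337 - 1 = 4 * 84 from rfl, pow_mul, hx] at h1
  exact key h1

/-- `(q,p) = (19,37)` lies on cell C2: `q ≡ 3 (8)`, `(q/7) = −1`, `p ≡ 5 (8)`, `(p/7) = +1`, `(p/q) = −1`, type α (`decide`). [folklore] -/
theorem cellC2_19_37 : Nat.Prime 19 ∧ Nat.Prime 37 ∧ 19 % 8 = 3 ∧ jacobiSym 19 7 = -1 ∧ 37 % 8 = 5 ∧ jacobiSym 37 7 = 1 ∧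
    jacobiSym 37 19 = -1 ∧ ¬ ∃ x : ZMod 37, x ^ 4 = -7 := by
  refine ⟨by norm_num, by norm_num, by norm_num, by norm_num, by norm_num, by norm_num, by norm_num, ?_⟩
  decide

/-- `(q,p) = (139,193)` lies on cell b31+: `q ≡ 3 (8)`, `(q/7) = −1`, `p ≡ 1 (8)`, `(p/7) = +1`, `(p/q) = +1`, and `25⁴ = −7` in `ZMod 193` (type β).
[folklore] -/
theorem cellB31_139_193 : Nat.Prime 139 ∧ Nat.Prime 193 ∧ 139 % 8 = 3 ∧ jacobiSym 139 7 = -1 ∧ 193 % 8 = 1 ∧ jacobiSym 193 7 = 1 ∧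
    jacobiSym 193 139 = 1 ∧ ∃ x : ZMod 193, x ^ 4 = -7 :=
  ⟨by norm_num, by norm_num, by norm_num, by norm_num, by norm_num, by norm_num, by norm_num, ⟨25, by decide⟩⟩

/-- `(q,p) = (311,193)` lies on cell b71+: `q ≡ 7 (8)`, `(q/7) = −1`, `p ≡ 1 (8)`, `(p/7) = +1`, `(p/q) = +1`, type β. [folklore] -/
theorem cellB71_311_193 : Nat.Prime 311 ∧ Nat.Prime 193 ∧ 311 % 8 = 7 ∧ jacobiSym 311 7 = -1 ∧ 193 % 8 = 1 ∧ jacobiSym 193 7 = 1 ∧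
    jacobiSym 193 311 = 1 ∧ ∃ x : ZMod 193, x ^ 4 = -7 :=
  ⟨by norm_num, by norm_num, by norm_num, by norm_num, by norm_num, by norm_num, by norm_num, ⟨25, by decide⟩⟩

end Cells

/-! ## §2 The negations: `hcell` cannot be dropped -/
section Negations

/-- **Cell C1 carries a member of rank `≥ 3`.** With the capstone's binders (`q > 3` prime, `q ≡ 3 (mod 4)`, `(q/7) = −1`; `p` prime, `p ≡ 1 (mod 4)`, `(−7/p) = 1`; `C • W = 49a1^{(−2qp)}`) and the cell clause of C1 — `(p/q) = −1 ∧ q ≡ 3 (8) ∧ (−7 not a fourth power mod p) ∧ p ≡ 1 (8)` — «`rank W(ℚ) = 1` for every such `W`» is FALSE: witness `(q,p) = (19,337)`. [cite: SilvermanTate2015, §3.6] -/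
theorem not_forall_mordellWeilRank_eq_one_cellC1 :
    ¬ ∀ {q p : ℕ} (_ : q.Prime) (_ : 3 < q) (_ : q % 4 = 3) (_ : jacobiSym q 7 = -1) [Fact p.Prime] (_ : p % 4 = 1)
        (_ : legendreSym p (-7) = 1) (_ : jacobiSym (p : ℤ) q = -1 ∧ q % 8 = 3 ∧ (¬ ∃ x : ZMod p, x ^ 4 = -7) ∧ p % 8 = 1)
        (W : WeierstrassCurve ℚ) [W.IsElliptic] (C : VariableChange ℚ),
        C • W = cm7.quadraticTwist (-(2 * (q : ℚ) * p)) → W.mordellWeilRank = 1 := by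
  intro h
  obtain ⟨hq, hp, hq8, hq7, hp8, hp7, hpq, htyp⟩ := cellC1_19_337
  haveI : Fact (Nat.Prime 337) := ⟨hp⟩
  haveI := isElliptic_quadraticTwist (W := cm7) (d := -(2 * ((19 : ℕ) : ℚ) * ((337 : ℕ) : ℚ))) (by norm_num)
  have h1 := @h 19 337 hq (by norm_num) (by norm_num) hq7 _ (by norm_num) (by rw [legendreSym_neg_seven_eq_jacobiSym (by norm_num)]; exact hp7)
    ⟨by exact_mod_cast hpq, hq8, htyp, hp8⟩ (cm7.quadraticTwist (-(2 * ((19 : ℕ) : ℚ) * ((337 : ℕ) : ℚ)))) _ 1 (one_smul _ _)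
  have h3 := three_le_mordellWeilRank_twoPrimesTwist_19_337 (cm7.quadraticTwist (-(2 * ((19 : ℕ) : ℚ) * ((337 : ℕ) : ℚ)))) 1 (one_smul _ _)
  omega

/-- **Cell C2 carries a member of rank `≥ 3`.** Capstone binders plus the cell clause of C2 — `(p/q) = −1 ∧ q ≡ 3 (8) ∧ (−7 not a fourth power mod p) ∧ p ≡ 5 (8)`: «`rank W(ℚ) = 1` for every such `W`» is FALSE: witness `(q,p) = (19,37)`. [cite: SilvermanTate2015, §3.6] -/
theorem not_forall_mordellWeilRank_eq_one_cellC2 :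
    ¬ ∀ {q p : ℕ} (_ : q.Prime) (_ : 3 < q) (_ : q % 4 = 3) (_ : jacobiSym q 7 = -1) [Fact p.Prime] (_ : p % 4 = 1)
        (_ : legendreSym p (-7) = 1) (_ : jacobiSym (p : ℤ) q = -1 ∧ q % 8 = 3 ∧ (¬ ∃ x : ZMod p, x ^ 4 = -7) ∧ p % 8 = 5)
        (W : WeierstrassCurve ℚ) [W.IsElliptic] (C : VariableChange ℚ),
        C • W = cm7.quadraticTwist (-(2 * (q : ℚ) * p)) → W.mordellWeilRank = 1 := by
  intro h
  obtain ⟨hq, hp, hq8, hq7, hp8, hp7, hpq, htyp⟩ := cellC2_19_37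
  haveI : Fact (Nat.Prime 37) := ⟨hp⟩
  haveI := isElliptic_quadraticTwist (W := cm7) (d := -(2 * ((19 : ℕ) : ℚ) * ((37 : ℕ) : ℚ))) (by norm_num)
  have h1 := @h 19 37 hq (by norm_num) (by norm_num) hq7 _ (by norm_num) (by rw [legendreSym_neg_seven_eq_jacobiSym (by norm_num)]; exact hp7)
    ⟨by exact_mod_cast hpq, hq8, htyp, hp8⟩ (cm7.quadraticTwist (-(2 * ((19 : ℕ) : ℚ) * ((37 : ℕ) : ℚ)))) _ 1 (one_smul _ _)
  have h3 := three_le_mordellWeilRank_twoPrimesTwist_19_37 (cm7.quadraticTwist (-(2 * ((19 : ℕ) : ℚ) * ((37 : ℕ) : ℚ)))) 1 (one_smul _ _)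
  omega

/-- **Cell b31+ carries a member of rank `≥ 3`.** Capstone binders plus the cell clause of b31+ — `(p/q) = +1 ∧ (−7 a fourth power mod p) ∧ p ≡ 1 (8) ∧ q ≡ 3 (8)`: «`rank W(ℚ) = 1` for every such `W`» is FALSE: witness `(q,p) = (139,193)`. [cite: SilvermanTate2015, §3.6] -/
theorem not_forall_mordellWeilRank_eq_one_cellB31plus :
    ¬ ∀ {q p : ℕ} (_ : q.Prime) (_ : 3 < q) (_ : q % 4 = 3) (_ : jacobiSym q 7 = -1) [Fact p.Prime] (_ : p % 4 = 1)
        (_ : legendreSym p (-7) = 1) (_ : jacobiSym (p : ℤ) q = 1 ∧ (∃ x : ZMod p, x ^ 4 = -7) ∧ p % 8 = 1 ∧ q % 8 = 3)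
        (W : WeierstrassCurve ℚ) [W.IsElliptic] (C : VariableChange ℚ),
        C • W = cm7.quadraticTwist (-(2 * (q : ℚ) * p)) → W.mordellWeilRank = 1 := by
  intro h
  obtain ⟨hq, hp, hq8, hq7, hp8, hp7, hpq, htyp⟩ := cellB31_139_193
  haveI : Fact (Nat.Prime 193) := ⟨hp⟩
  haveI := isElliptic_quadraticTwist (W := cm7) (d := -(2 * ((139 : ℕ) : ℚ) * ((193 : ℕ) : ℚ))) (by norm_num)
  have h1 := @h 139 193 hq (by norm_num) (by norm_num) hq7 _ (by norm_num) (by rw [legendreSym_neg_seven_eq_jacobiSym (by norm_num)]; exact hp7)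
    ⟨by exact_mod_cast hpq, htyp, hp8, hq8⟩ (cm7.quadraticTwist (-(2 * ((139 : ℕ) : ℚ) * ((193 : ℕ) : ℚ)))) _ 1 (one_smul _ _)
  have h3 := three_le_mordellWeilRank_twoPrimesTwist_139_193 (cm7.quadraticTwist (-(2 * ((139 : ℕ) : ℚ) * ((193 : ℕ) : ℚ)))) 1 (one_smul _ _)
  omega

/-- **Cell b71+ carries a member of rank `≥ 3`.** Capstone binders plus the cell clause of b71+ — `(p/q) = +1 ∧ (−7 a fourth power mod p) ∧ p ≡ 1 (8) ∧ q ≡ 7 (8)`: «`rank W(ℚ) = 1` for every such `W`» is FALSE: witness `(q,p) = (311,193)`. [cite: SilvermanTate2015, §3.6] -/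
theorem not_forall_mordellWeilRank_eq_one_cellB71plus :
    ¬ ∀ {q p : ℕ} (_ : q.Prime) (_ : 3 < q) (_ : q % 4 = 3) (_ : jacobiSym q 7 = -1) [Fact p.Prime] (_ : p % 4 = 1)
        (_ : legendreSym p (-7) = 1) (_ : jacobiSym (p : ℤ) q = 1 ∧ (∃ x : ZMod p, x ^ 4 = -7) ∧ p % 8 = 1 ∧ q % 8 = 7)
        (W : WeierstrassCurve ℚ) [W.IsElliptic] (C : VariableChange ℚ),
        C • W = cm7.quadraticTwist (-(2 * (q : ℚ) * p)) → W.mordellWeilRank = 1 := by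
  intro h
  obtain ⟨hq, hp, hq8, hq7, hp8, hp7, hpq, htyp⟩ := cellB71_311_193
  haveI : Fact (Nat.Prime 193) := ⟨hp⟩
  haveI := isElliptic_quadraticTwist (W := cm7) (d := -(2 * ((311 : ℕ) : ℚ) * ((193 : ℕ) : ℚ))) (by norm_num)
  have h1 := @h 311 193 hq (by norm_num) (by norm_num) hq7 _ (by norm_num) (by rw [legendreSym_neg_seven_eq_jacobiSym (by norm_num)]; exact hp7)
    ⟨by exact_mod_cast hpq, htyp, hp8, hq8⟩ (cm7.quadraticTwist (-(2 * ((311 : ℕ) : ℚ) * ((193 : ℕ) : ℚ)))) _ 1 (one_smul _ _)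
  have h3 := three_le_mordellWeilRank_twoPrimesTwist_311_193 (cm7.quadraticTwist (-(2 * ((311 : ℕ) : ℚ) * ((193 : ℕ) : ℚ)))) 1 (one_smul _ _)
  omega

/-- **THE NON-SHARP LOCUS AS THE CAPSTONE SPELLS IT.** Capstone binders plus the COMPLEMENT clause of its §0 `twoPrimes_sharpLocus_or_nonSharp` (`(p/q) = −1 ∧ q ≡ 3 (8) ∧ α`, i.e. C1 ∪ C2, or `(p/q) = +1 ∧ β ∧ p ≡ 1 (8)`, i.e. b31+ ∪ b71+): «`rank W(ℚ) = 1` for every such `W`» is FALSE (witness `(311,193)`). [cite: SilvermanTate2015, §3.6] -/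
theorem not_forall_mordellWeilRank_eq_one_nonSharpLocus :
    ¬ ∀ {q p : ℕ} (_ : q.Prime) (_ : 3 < q) (_ : q % 4 = 3) (_ : jacobiSym q 7 = -1) [Fact p.Prime] (_ : p % 4 = 1)
        (_ : legendreSym p (-7) = 1)
        (_ : (jacobiSym (p : ℤ) q = -1 ∧ q % 8 = 3 ∧ ¬ ∃ x : ZMod p, x ^ 4 = -7) ∨
          (jacobiSym (p : ℤ) q = 1 ∧ (∃ x : ZMod p, x ^ 4 = -7) ∧ p % 8 = 1))
        (W : WeierstrassCurve ℚ) [W.IsElliptic] (C : VariableChange ℚ),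
        C • W = cm7.quadraticTwist (-(2 * (q : ℚ) * p)) → W.mordellWeilRank = 1 := by
  intro h
  obtain ⟨hq, hp, _, hq7, hp8, hp7, hpq, htyp⟩ := cellB71_311_193
  haveI : Fact (Nat.Prime 193) := ⟨hp⟩
  haveI := isElliptic_quadraticTwist (W := cm7) (d := -(2 * ((311 : ℕ) : ℚ) * ((193 : ℕ) : ℚ))) (by norm_num)
  have h1 := @h 311 193 hq (by norm_num) (by norm_num) hq7 _ (by norm_num) (by rw [legendreSym_neg_seven_eq_jacobiSym (by norm_num)]; exact hp7)
    (Or.inr ⟨by exact_mod_cast hpq, htyp, hp8⟩) (cm7.quadraticTwist (-(2 * ((311 : ℕ) : ℚ) * ((193 : ℕ) : ℚ)))) _ 1 (one_smul _ _)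
  have h3 := three_le_mordellWeilRank_twoPrimesTwist_311_193 (cm7.quadraticTwist (-(2 * ((311 : ℕ) : ℚ) * ((193 : ℕ) : ℚ)))) 1 (one_smul _ _)
  omega

/-- **THE CAPSTONE'S `hcell` CANNOT BE DROPPED.** With exactly the binders of `analyticRank_eq_one_twoPrimesTwist_sharpLocus_of_print` minus `hcell` (`q > 3` prime, `q ≡ 3 (mod 4)`, `(q/7) = −1`; `p` prime, `p ≡ 1 (mod 4)`, `(−7/p) = +1`; `C • W = 49a1^{(−2qp)}`), already the rank clause `rank W(ℚ) = 1` FAILS: `(q,p) = (311,193)` (cell b71+) has a member of rank `≥ 3` — and so do `(19,337)` on C1, `(19,37)` on C2, `(139,193)` on b31+, one per excluded cell (the four theorems above). With §0 `twoPrimes_sharpLocus_or_nonSharp` of the capstone: THEOREM A⁗ is BEST POSSIBLE at the level of the sixteen cells — twelve cells proved (modulo named print), each of the four others refuted for cell-uniform rank one (unconditionally). [cite: SilvermanTate2015, §3.6] -/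
theorem not_forall_mordellWeilRank_eq_one_twoPrimesTwist :
    ¬ ∀ {q p : ℕ} (_ : q.Prime) (_ : 3 < q) (_ : q % 4 = 3) (_ : jacobiSym q 7 = -1) [Fact p.Prime] (_ : p % 4 = 1)
        (_ : legendreSym p (-7) = 1) (W : WeierstrassCurve ℚ) [W.IsElliptic] (C : VariableChange ℚ),
        C • W = cm7.quadraticTwist (-(2 * (q : ℚ) * p)) → W.mordellWeilRank = 1 := by
  intro h
  obtain ⟨hq, hp, _, hq7, _, hp7, _, _⟩ := cellB71_311_193
  haveI : Fact (Nat.Prime 193) := ⟨hp⟩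
  haveI := isElliptic_quadraticTwist (W := cm7) (d := -(2 * ((311 : ℕ) : ℚ) * ((193 : ℕ) : ℚ))) (by norm_num)
  have h1 := @h 311 193 hq (by norm_num) (by norm_num) hq7 _ (by norm_num) (by rw [legendreSym_neg_seven_eq_jacobiSym (by norm_num)]; exact hp7)
    (cm7.quadraticTwist (-(2 * ((311 : ℕ) : ℚ) * ((193 : ℕ) : ℚ)))) _ 1 (one_smul _ _)
  have h3 := three_le_mordellWeilRank_twoPrimesTwist_311_193 (cm7.quadraticTwist (-(2 * ((311 : ℕ) : ℚ) * ((193 : ℕ) : ℚ)))) 1 (one_smul _ _)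
  omega

end Negations

end Summit.BirchSwinnertonDyer.BirchSwinnertonDyer.Theorems.GoldfeldGoodTwists

end
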